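/-
HONEST FRAMING: certified error envelopes and provably optimal rounding/accumulation schemes for
low-precision formats under stated cost models; every table by two implementations; no hardware
or vendor claims.
-/
/-
# T9(h) — THE PLACEMENT LAW: where to spend k wide additions in a narrow running sum

Venture CertifiedArithmetic / LowPrec, OPT seat gen 9 (OPTIMA.md §B, Theorem T9(h)).
-/
import Summits.Ventures.CertifiedArithmetic.LowPrec.OptChainLabelsRNEConverse

/-!
# The placement law (T9(h)): a provably optimal two-format accumulation scheme

COST MODEL (CM-B / placement).  A running sum of `n` nonnegative terms is kept in the NARROW format
`F(p)`; a budget allows `k` of the `n` additions to be performed in the WIDE format `F(q)`, `p < q`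
(the wide adder reads the `F(p)` running sum directly, `F(p) ⊆ F(q)`); the narrow adder only
accepts `F(p)` operands, so a maximal run of wide additions must be DEMOTED (one rounding into
`F(p)`) before the next narrow addition, and at the end (the result is delivered in `F(p)`).  A
SCHEME is the placement `w : List Bool` of the wide additions (`true` = wide); its labelled chain
(T9) is `placePat q p false w`.

THE LAW (`ueffP_placePat`, `placement_exact_le`, `placement_attained`): the exact worst-case
constant of the scheme `w` over all round-to-nearest families and all nonnegative data is
`1 + U(w)`, `U(w) = (n-k) u_p + k u_q + b(w) u_p`, where `b(w)` is the number of maximal wide runs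
— every run costs one demotion.  OPTIMUM (`placeU_ge`, `placeU_contig`): for `k ≥ 1`,
`U(w) ≥ (n-k) u_p + k u_q + u_p` with equality iff the wide additions are CONTIGUOUS (one run,
anywhere); fragmentation into `b` runs costs exactly `(b-1) u_p` more in the worst case.
ROUND-TO-NEAREST-EVEN (`rneGap_placePat`, `placement_rne_attained`, `placement_rne_strict`): for
`q ≥ p + 2` every ties-to-even family attains `1 + U(w)` for every placement; for `q = p + 1` every
ties-to-even family is strict on every placement with `k ≥ 1`.
-/

namespace Summit.Ventures.CertifiedArithmetic.LowPrec.Opt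

open Literature.ComputerArithmetic.JeannerodRump2018

/-! ## Placements and their chains -/

/-- Precision of the running sum in state `b` (`true` = inside a wide run). -/
def stPrec (q p : ℕ) : Bool → ℕ
  | true => q
  | false => p

/-- THE CHAIN OF A PLACEMENT.  `placePat q p b w`: the add/convert pattern (T9(f); entries
`(precision, isConversion)`) executed for the placement `w` (`true` = a wide addition at `q`,
`false` = a narrow addition at `p`) from state `b`: a demotion `(p, true)` is inserted before every
narrow addition that follows a wide one, and after a final wide run. -/
def placePat (q p : ℕ) : Bool → List Bool → List (ℕ × Bool)
  | false, [] => []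
  | true, [] => [(p, true)]
  | false, false :: w => (p, false) :: placePat q p false w
  | false, true :: w => (q, false) :: placePat q p true w
  | true, true :: w => (q, false) :: placePat q p true w
  | true, false :: w => (p, true) :: (p, false) :: placePat q p false w

/-- Number of wide additions of a placement. -/
def nW : List Bool → ℕ
  | [] => 0
  | true :: w => nW w + 1
  | false :: w => nW w

/-- Number of narrow additions of a placement. -/
def nN : List Bool → ℕ
  | [] => 0
  | true :: w => nN w
  | false :: w => nN w + 1

/-- Number of maximal wide runs STARTING inside `w`, entered in state `b`. -/
def newRuns : Bool → List Bool → ℕ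
  | _, [] => 0
  | false, true :: w => newRuns true w + 1
  | true, true :: w => newRuns true w
  | _, false :: w => newRuns false w

/-- One pending demotion if we are inside a wide run. -/
def pend : Bool → ℕ
  | true => 1
  | false => 0

/-- THE PLACEMENT CONSTANT `U(w)` (from state `b`): narrow additions cost `u_p`, wide additions
`u_q`, and every wide run one demotion `u_p`. -/
def placeU (q p : ℕ) (b : Bool) (w : List Bool) : ℚ :=
  (nN w : ℚ) * unitRoundoff p + (nW w : ℚ) * unitRoundoff q
    + ((newRuns b w + pend b : ℕ) : ℚ) * unitRoundoff p

/-- Every wide and narrow addition is an addition: `nN w + nW w = n`. -/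
theorem nN_add_nW : ∀ w : List Bool, nN w + nW w = w.length
  | [] => rfl
  | true :: w => by simp only [nN, nW, List.length_cons]; have := nN_add_nW w; omega
  | false :: w => by simp only [nN, nW, List.length_cons]; have := nN_add_nW w; omega

/-! ## The closed form of the effective constant -/

/-- THE PLACEMENT LAW, COMBINATORIAL CORE: the effective unit-roundoff sum (T9(f)) of the chain of
the placement `w` is `U(w) = (n-k) u_p + k u_q + b(w) u_p`. -/
theorem ueffP_placePat {q p : ℕ} (hpq : p < q) :
    ∀ (w : List Bool) (b : Bool), ueffP (stPrec q p b) (placePat q p b w) = placeU q p b w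
  | [], false => by simp [placePat, ueffP, placeU, nN, nW, newRuns, pend]
  | [], true => by simp [stPrec, placePat, ueffP, placeU, nN, nW, newRuns, pend, not_le.mpr hpq]
  | false :: w, false => by
      have ih := ueffP_placePat hpq w false
      simp only [stPrec] at ih ⊢
      simp only [placePat, ueffP, ih, placeU, nN, nW, newRuns, pend]
      push_cast; ring
  | true :: w, false => by
      have ih := ueffP_placePat hpq w true
      simp only [stPrec] at ih ⊢
      simp only [placePat, ueffP, ih, placeU, nN, nW, newRuns, pend]
      push_cast; ring
  | true :: w, true => by
      have ih := ueffP_placePat hpq w true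
      simp only [stPrec] at ih ⊢
      simp only [placePat, ueffP, ih, placeU, nN, nW, newRuns, pend]
      push_cast; ring
  | false :: w, true => by
      have ih := ueffP_placePat hpq w false
      simp only [stPrec] at ih ⊢
      simp only [placePat, ueffP, if_neg (not_le.mpr hpq), ih, placeU, nN, nW, newRuns, pend]
      push_cast; ring

/-- The closed form from the initial state (running sum in `F(p)`). -/
theorem ueffP_placePat_start {q p : ℕ} (hpq : p < q) (w : List Bool) :
    ueffP p (placePat q p false w) = placeU q p false w := by
  simpa [stPrec] using ueffP_placePat hpq w false

/-- The effective sum of a chain is the effective sum of its pattern. -/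
theorem ueff_eq_ueffP : ∀ (e : ℕ) (ss : List LStep), ueff e ss = ueffP e (ss.map lpat)
  | _, [] => by simp [ueff, ueffP]
  | e, s :: ss => by
      have ih1 := ueff_eq_ueffP e ss
      have ih2 := ueff_eq_ueffP s.prec ss
      by_cases hx : s.x = 0
      · by_cases he : e ≤ s.prec
        · simp [lpat, hx, he, ueff_cons, ueffP, ih1]
        · simp [lpat, hx, he, ueff_cons, ueffP, ih2]
      · simp [lpat, hx, ueff_cons, ueffP, ih2]

/-- The precisions occurring in a placement chain are `p` and `q`. -/
theorem mem_placePat {q p : ℕ} :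
    ∀ (w : List Bool) (b : Bool) (r : ℕ × Bool), r ∈ placePat q p b w → r.1 = p ∨ r.1 = q
  | [], false, r, h => by simp [placePat] at h
  | [], true, r, h => by simp [placePat] at h; simp [h]
  | false :: w, false, r, h => by
      simp only [placePat, List.mem_cons] at h
      rcases h with h | h
      · simp [h]
      · exact mem_placePat w false r h
  | true :: w, false, r, h => by
      simp only [placePat, List.mem_cons] at h
      rcases h with h | h
      · simp [h]
      · exact mem_placePat w true r h
  | true :: w, true, r, h => by
      simp only [placePat, List.mem_cons] at h
      rcases h with h | h
      · simp [h]
      · exact mem_placePat w true r h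
  | false :: w, true, r, h => by
      simp only [placePat, List.mem_cons] at h
      rcases h with h | h | h
      · simp [h]
      · simp [h]
      · exact mem_placePat w false r h

/-- A placement chain starts with an addition: its initial conversion run is empty. -/
theorem Rsum_placePat (q p e : ℕ) : ∀ w : List Bool, Rsum e (placePat q p false w) = 0
  | [] => by simp [placePat, Rsum]
  | false :: w => by simp [placePat, Rsum]
  | true :: w => by simp [placePat, Rsum]

/-! ## The law: bound for every scheme, attained for every scheme -/

/-- THE PLACEMENT LAW, UPPER BOUND (T9(h)): every admissible labelled chain executing the placement
`w` (any nearest roundings, any tie rules, all nonnegative grid data) from a start value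
`acc ∈ F(p)`, `acc ≥ 0`, satisfies `acc + Σ x_i ≤ (1 + U(w)) · S_n`. -/
theorem placement_exact_le {emin : ℤ} {q p : ℕ} (hpq : p < q) (w : List Bool)
    (ss : List LStep) (hpat : ss.map lpat = placePat q p false w) (acc : ℚ) (hacc0 : 0 ≤ acc)
    (haccF : IsFloat p emin acc) (hok : ∀ s ∈ ss, s.OK emin) :
    acc + xsum ss ≤ (1 + placeU q p false w) * lchainEval acc ss := by
  have h := exact_le_lchain_eff ss acc hacc0 haccF hok
  rwa [ueff_eq_ueffP, hpat, ueffP_placePat_start hpq] at h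

/-- THE PLACEMENT LAW, SHARPNESS (T9(h)): for every placement `w`, at every scale `2^E` clear of
underflow, ties-downward nearest roundings and the T9(f) witness data executing `w` from
`acc = 2^E` give `S_n = 2^E` and `acc + Σ x_i = (1 + U(w)) · S_n` exactly. -/
theorem placement_attained {emin E : ℤ} {fl : ℕ → ℚ → ℚ}
    (hfl : ∀ π, IsRoundNearest π emin (fl π) ∧ TiesDown π emin (fl π))
    {q p : ℕ} (hp : 1 ≤ p) (hpq : p < q) (hE : emin + q ≤ E) (w : List Bool) :
    (witSteps fl E (placePat q p false w)).map lpat = placePat q p false w ∧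
    (∀ s ∈ witSteps fl E (placePat q p false w), s.OK emin) ∧
    lchainEval ((2 : ℚ) ^ E) (witSteps fl E (placePat q p false w)) = (2 : ℚ) ^ E ∧
    (2 : ℚ) ^ E + xsum (witSteps fl E (placePat q p false w))
      = (1 + placeU q p false w) * (2 : ℚ) ^ E := by
  have hP : ∀ r ∈ placePat q p false w, 1 ≤ r.1 ∧ emin + r.1 ≤ E := by
    intro r hr
    rcases mem_placePat w false r hr with h | h <;> (rw [h]; constructor <;> omega)
  have h := lchain_eff_attained hfl hp (by omega) (placePat q p false w) hP
  rw [Rsum_placePat] at h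
  simp only [add_zero, mul_one] at h
  obtain ⟨-, hok, hev, heq⟩ := h
  refine ⟨map_witSteps fl E _, hok, hev, ?_⟩
  rw [heq, hev, ueff_witSteps, ueffP_placePat_start hpq]

/-! ## The optimum: contiguous placement -/

/-- A placement holding a wide addition (or entered inside a wide run) pays at least one
demotion. -/
theorem one_le_newRuns_add_pend :
    ∀ (w : List Bool) (b : Bool), (b = true ∨ true ∈ w) → 1 ≤ newRuns b w + pend b
  | [], false, h => by simp at h
  | [], true, _ => by simp [newRuns, pend]
  | true :: w, false, _ => by simp [newRuns, pend]
  | true :: w, true, _ => by simp [newRuns, pend]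
  | false :: w, false, h => by
      have h' : true ∈ w := by simpa using h
      have := one_le_newRuns_add_pend w false (Or.inr h')
      simpa [newRuns, pend] using this
  | false :: w, true, _ => by simp [newRuns, pend]

/-- THE PLACEMENT LAW, LOWER BOUND OVER SCHEMES (T9(h)): every placement of `k ≥ 1` wide additions
among `n` has `U(w) ≥ (n-k) u_p + k u_q + u_p`. -/
theorem placeU_ge (q p : ℕ) (w : List Bool) (hw : true ∈ w) :
    (nN w : ℚ) * unitRoundoff p + (nW w : ℚ) * unitRoundoff q + unitRoundoff p
      ≤ placeU q p false w := by
  have h1 : (1 : ℚ) ≤ ((newRuns false w + pend false : ℕ) : ℚ) := by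
    exact_mod_cast one_le_newRuns_add_pend w false (Or.inr hw)
  have hu := unitRoundoff_nonneg p
  unfold placeU
  nlinarith

/-- The CONTIGUOUS placement: `a` narrow additions, then `k` wide ones, then `c` narrow ones. -/
def contig (a k c : ℕ) : List Bool :=
  List.replicate a false ++ List.replicate k true ++ List.replicate c false

/-- `nN` is additive. -/
theorem nN_append : ∀ l m : List Bool, nN (l ++ m) = nN l + nN m
  | [], m => by simp [nN]
  | true :: l, m => by simp [nN, nN_append l m]
  | false :: l, m => by simp [nN, nN_append l m]; omega

/-- `nW` is additive. -/
theorem nW_append : ∀ l m : List Bool, nW (l ++ m) = nW l + nW m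
  | [], m => by simp [nW]
  | true :: l, m => by simp [nW, nW_append l m]; omega
  | false :: l, m => by simp [nW, nW_append l m]

/-- `nN` of a narrow run. -/
theorem nN_replicate_false : ∀ a : ℕ, nN (List.replicate a false) = a
  | 0 => rfl
  | a + 1 => by simp [List.replicate_succ, nN, nN_replicate_false a]

/-- `nN` of a wide run. -/
theorem nN_replicate_true : ∀ k : ℕ, nN (List.replicate k true) = 0
  | 0 => rfl
  | k + 1 => by simp [List.replicate_succ, nN, nN_replicate_true k]

/-- `nW` of a narrow run. -/
theorem nW_replicate_false : ∀ a : ℕ, nW (List.replicate a false) = 0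
  | 0 => rfl
  | a + 1 => by simp [List.replicate_succ, nW, nW_replicate_false a]

/-- `nW` of a wide run. -/
theorem nW_replicate_true : ∀ k : ℕ, nW (List.replicate k true) = k
  | 0 => rfl
  | k + 1 => by simp [List.replicate_succ, nW, nW_replicate_true k]

/-- A nonempty narrow run resets the state. -/
theorem newRuns_narrowRun (l : List Bool) :
    ∀ (a : ℕ) (b : Bool), newRuns b (List.replicate (a + 1) false ++ l) = newRuns false l
  | 0, b => by cases b <;> rfl
  | a + 1, b => by
      rw [List.replicate_succ, List.cons_append]
      cases b <;> exact newRuns_narrowRun l a false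

/-- Inside a wide run further wide additions start no new run. -/
theorem newRuns_wideRun_true (l : List Bool) :
    ∀ k : ℕ, newRuns true (List.replicate k true ++ l) = newRuns true l
  | 0 => by simp
  | k + 1 => by
      rw [List.replicate_succ, List.cons_append]
      exact newRuns_wideRun_true l k

/-- A nonempty wide run entered from the narrow state starts exactly one run. -/
theorem newRuns_wideRun_false (l : List Bool) (k : ℕ) :
    newRuns false (List.replicate (k + 1) true ++ l) = newRuns true l + 1 := by
  rw [List.replicate_succ, List.cons_append]
  show newRuns true (List.replicate k true ++ l) + 1 = newRuns true l + 1
  rw [newRuns_wideRun_true]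

/-- A narrow run starts no wide run. -/
theorem newRuns_replicate_false : ∀ (c : ℕ) (b : Bool), newRuns b (List.replicate c false) = 0
  | 0, b => by cases b <;> rfl
  | c + 1, b => by
      rw [List.replicate_succ]
      cases b <;> exact newRuns_replicate_false c false

/-- The contiguous placement of `k + 1` wide additions has exactly one wide run. -/
theorem newRuns_contig (a k c : ℕ) : newRuns false (contig a (k + 1) c) = 1 := by
  unfold contig
  rw [List.append_assoc]
  cases a with
  | zero => simp [newRuns_wideRun_false, newRuns_replicate_false]
  | succ a => rw [newRuns_narrowRun, newRuns_wideRun_false, newRuns_replicate_false]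

/-- THE PLACEMENT LAW, THE OPTIMUM IS ATTAINED BY CONTIGUITY (T9(h)): the contiguous placement has
`U = (n-k) u_p + k u_q + u_p` — the lower bound of `placeU_ge`. -/
theorem placeU_contig (q p a k c : ℕ) :
    placeU q p false (contig a (k + 1) c)
      = ((a + c : ℕ) : ℚ) * unitRoundoff p + ((k + 1 : ℕ) : ℚ) * unitRoundoff q
          + unitRoundoff p := by
  have hN : nN (contig a (k + 1) c) = a + c := by
    simp [contig, nN_append, nN_replicate_false, nN_replicate_true]
  have hW : nW (contig a (k + 1) c) = k + 1 := by
    simp [contig, nW_append, nW_replicate_false, nW_replicate_true]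
  rw [placeU, hN, hW, newRuns_contig]
  simp [pend]

/-- WIDENING PAYS IFF the saving beats the demotion: the contiguous scheme with `k + 1` wide
additions beats the all-narrow scheme (`U = n u_p`, T4(d)) iff `(k+1)(u_p - u_q) > u_p`. -/
theorem placeU_contig_lt_allNarrow_iff (q p a k c : ℕ) :
    placeU q p false (contig a (k + 1) c) < ((a + (k + 1) + c : ℕ) : ℚ) * unitRoundoff p ↔
      unitRoundoff p < ((k + 1 : ℕ) : ℚ) * (unitRoundoff p - unitRoundoff q) := by
  rw [placeU_contig]
  push_cast
  constructor <;> intro h <;> linarith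

/-! ## Registered form -/

/-- THE PLACEMENT LAW (OPTIMA.md §B, T9(h); cost model CM-B/placement): for formats `1 ≤ p < q`,
(1) every admissible chain executing a placement `w` from `acc ∈ F(p)`, `acc ≥ 0`, has
`acc + Σ x_i ≤ (1 + U(w)) · S_n`, `U(w) = (n-k) u_p + k u_q + b(w) u_p`; (2) for every `w` and every
scale `E ≥ emin + q` some admissible chain executing `w` from some `acc ∈ F(p)` (nearest
roundings) has `S_n = 2^E` and equality; (3) every placement with a wide addition has
`U(w) ≥ (n-k) u_p + k u_q + u_p`; (4) the contiguous placement achieves it; (5) it beats the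
all-narrow scheme `n u_p` iff `k (u_p - u_q) > u_p`; (0) `n = (n-k) + k`. -/
def R4_PlacementLaw : Prop :=
  ∀ (q p : ℕ), 1 ≤ p → p < q →
    (∀ w : List Bool, nN w + nW w = w.length) ∧
    (∀ (emin : ℤ) (w : List Bool) (ss : List LStep) (acc : ℚ),
        ss.map lpat = placePat q p false w → 0 ≤ acc → IsFloat p emin acc →
        (∀ s ∈ ss, s.OK emin) → acc + xsum ss ≤ (1 + placeU q p false w) * lchainEval acc ss) ∧
    (∀ (emin E : ℤ) (w : List Bool), emin + q ≤ E →
        ∃ (acc : ℚ) (ws : List LStep), ws.map lpat = placePat q p false w ∧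
          IsFloat p emin acc ∧ (∀ s ∈ ws, s.OK emin) ∧ lchainEval acc ws = (2 : ℚ) ^ E ∧
          acc + xsum ws = (1 + placeU q p false w) * lchainEval acc ws) ∧
    (∀ w : List Bool, true ∈ w →
        (nN w : ℚ) * unitRoundoff p + (nW w : ℚ) * unitRoundoff q + unitRoundoff p
          ≤ placeU q p false w) ∧
    (∀ a k c : ℕ, placeU q p false (contig a (k + 1) c)
        = ((a + c : ℕ) : ℚ) * unitRoundoff p + ((k + 1 : ℕ) : ℚ) * unitRoundoff q
            + unitRoundoff p) ∧
    (∀ a k c : ℕ,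
        placeU q p false (contig a (k + 1) c) < ((a + (k + 1) + c : ℕ) : ℚ) * unitRoundoff p ↔
          unitRoundoff p < ((k + 1 : ℕ) : ℚ) * (unitRoundoff p - unitRoundoff q))

/-- `R4_PlacementLaw` holds. -/
theorem R4_PlacementLaw_holds : R4_PlacementLaw := by
  intro q p hp hpq
  refine ⟨nN_add_nW, fun emin w ss acc hpat hacc0 haccF hok =>
      placement_exact_le hpq w ss hpat acc hacc0 haccF hok, ?_, placeU_ge q p, placeU_contig q p,
      placeU_contig_lt_allNarrow_iff q p⟩
  intro emin E w hE
  obtain ⟨fl, hfl⟩ := exists_tiesDown_family emin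
  obtain ⟨hmap, hok, hev, heq⟩ := placement_attained hfl hp hpq hE w
  refine ⟨(2 : ℚ) ^ E, witSteps fl E (placePat q p false w), hmap, ?_, hok, hev, ?_⟩
  · exact PTree.isFloat_two_zpow hp (by omega)
  · rw [hev]; exact heq

end Summit.Ventures.CertifiedArithmetic.LowPrec.Opt
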